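import Literature.AlgebraicGeometry.Frobenioids.Thm36SubPfModelQ
import HarnessLib

/-!
# Frobenioids II, Thm. 3.6 (i)/(v) at `Λ = ℚ`: the two natural unit coordinates of `C^pf` AGREE, and the
# unit transport law for `unitsPerfEquivNat` (bridge; proof-only)

Mochizuki, *The geometry of Frobenioids II: poly-Frobenioids*, Kyushu J. Math. **62** (2008) 401–460, §3,
Thm. 3.6 (i) p. 36, (v) p. 37 [cite: MochizukiFrdII2008, Thm 3.6 (v) p.37]; [FrdI] Prop. 4.4 (iv) p. 83
[cite: MochizukiFrdI2008, Prop. 4.4 (iv) p.83].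

abc-iut cell, layer L1, row M13-c3.  Two seats repaired the unit normalisation of the identification
`(Φ^fld)^pf(d) ≃ O^×(X^birat)` in parallel (finding F-w5d246-1): abc-iut-w5-d246
(`D0.twistUnit`, `Thm36Sub.unitRekey`, `isoOfSectionTw`, closer `istrModel_Q_holds`, `Thm36SubPfModelQ.lean`) and
abc-iut-L1-t6 (`D0.unitTwist`, `Thm36Sub.unitsPerfEquivNat`, `isoOfSectionE`,
`ArchimedeanPerfectionRationalFunctionMonoidE.lean` / `…Str.lean` v2).  This file records, in the kernel, that the
two vocabularies denote the SAME objects — so that either API may be cited and a later de-duplication is safe: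
* `D0.unitTwist_eq_twistUnit` — the two Galois-twist endomorphisms of `O_K^×` are equal (definitionally);
* `Thm36Sub.unitsPerfEquivNat_eq` — `unitsPerfEquivNat X = unitsPerfEquiv X ∘ unitRekey X`;
* `Thm36Sub.isoOfSectionE_nat_eq_isoOfSectionTw` — `isoOfSectionE X (unitsPerfEquivNat X) σ hσ = isoOfSectionTw X σ hσ`;
* `Thm36Sub.intertwines_unitsPerfEquivNat` — the unit transport law (T-unit) in the `unitsPerfEquivNat` form (the
  `hunit` binder of `istrModel_Q_of_sectionNat`), from abc-iut-w5-d246's `intertwines_unitsPerfEquiv_pow_pull`;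
* no second closer is stated: the closer of record is `istrModel_Q_holds` (abc-iut-w5-d246); the generic route
  `rationalFunctionMonoidStr_Q_of_sectionNat π hF (fun X => radialSectionGp π hF X) (fun X x => divHom_radialSectionGp π hF X x)
  (fun _ _ ψ hψ z => intertwines_radialSectionGp π hF ψ hψ z) (fun _ _ ψ hψ w => intertwines_unitsPerfEquivNat ψ hψ w)`
  elaborates to the statement of `rationalFunctionMonoidStr_Q` (checked; not re-declared, `dedup.landed`).
Proof-only; [FrdII] §3 is classical; nothing here bears on [IUTchIII] Cor. 3.12.
-/

noncomputable section

namespace Literature.AlgebraicGeometry.Frobenioids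

open CategoryTheory Opposite

namespace ArchFrd

/-- The two names of the Galois twist on `O_K^×` agree. [cite: MochizukiFrdII2008, Def 3.1 (ii) p.23] -/
theorem D0.unitTwist_eq_twistUnit (σ : Bool) (K : D0) : D0.unitTwist σ K = D0.twistUnit σ K := rfl

namespace Thm36Sub

universe v u

variable {D : Type u} [Category.{v} D] {π : D ⥤ D0} {hF : PreFrobenioid.IsFrobenioid (C.toElem π)}

open PreFrobenioid PreFrobenioid.Perfection

/-- **`unitsPerfEquivNat X = unitsPerfEquiv X ∘ unitRekey X`** (abc-iut-L1-t6's natural coordinate is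
abc-iut-w5-d246's re-keying followed by the level coordinate). [cite: MochizukiFrdII2008, Thm 3.6 (v) p.37] -/
theorem unitsPerfEquivNat_eq (X : pfCat π hF) (p : Frobenioids.Perfection (D0.unitScalars (π.obj X.obj.snd))) :
    unitsPerfEquivNat X p = unitsPerfEquiv X (unitRekey X p) := rfl

/-- **The two re-keyed identifications coincide**: `isoOfSectionE X (unitsPerfEquivNat X) σ hσ = isoOfSectionTw X σ hσ`.
[cite: MochizukiFrdII2008, Thm 3.6 (i) p.36] -/
theorem isoOfSectionE_nat_eq_isoOfSectionTw (X : pfCat π hF)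
    (σ : PhiGp (pfStr π hF) X →* BiratUnits (pfStr π hF) (pf_isFrobenioid π hF) X)
    (hσ : ∀ x, BiratUnits.divHom (pf_isFrobenioid π hF) X (σ x) = x) :
    isoOfSectionE X (unitsPerfEquivNat X) σ hσ = isoOfSectionTw X σ hσ := by
  refine MulEquiv.ext fun b => ?_
  rw [isoOfSectionE_apply, show isoOfSectionTw X σ hσ b = isoOfSection X σ hσ (rekey X b) from rfl,
    isoOfSection_apply, map_fst_rekey]
  congr 2
  -- the unit coordinates: `pr₂^pf (rekey b) = unitRekey (pr₂^pf b)`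
  have h2 : (Frobenioids.Perfection.toProd (rekey X b)).2 = unitRekey X (Frobenioids.Perfection.toProd b).2 := by
    unfold rekey
    rw [MulEquiv.trans_apply, MulEquiv.trans_apply, Frobenioids.Perfection.toProd_symm_apply]
    rfl
  rw [Frobenioids.Perfection.toProd_apply_eq, Frobenioids.Perfection.toProd_apply_eq] at h2
  exact congrArg (unitsPerfEquiv X) h2.symm

/-- `unitsPerfEquiv` commutes with powers (as a rewriting lemma). [cite: MochizukiFrdII2008, Thm 3.6 (v) p.37] -/
theorem unitsPerfEquiv_pow (X : pfCat π hF) (p : Frobenioids.Perfection (D0.unitScalars (π.obj X.obj.snd))) (n : ℕ) :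
    unitsPerfEquiv X (p ^ n) = unitsPerfEquiv X p ^ n :=
  (unitsPerfEquiv X).toMonoidHom.map_pow p n

/-- **(T-unit) for the natural coordinate**: along a linear `ψ : X → X'` of `C^pf`, the units
`unitsPerfEquivNat X [ψ^* w]` and `unitsPerfEquivNat X' [w]` are intertwined — the `hunit` binder of
`istrModel_Q_of_sectionNat`, from abc-iut-w5-d246's `intertwines_unitsPerfEquiv_pow_pull`.
[cite: MochizukiFrdI2008, Prop. 4.4 (iv) p.83] -/
theorem intertwines_unitsPerfEquivNat {X X' : pfCat π hF} (ψ : X ⟶ X') (hψ : IsLinear (pfStr π hF) ψ)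
    (w : D0.unitScalars (π.obj X'.obj.snd)) :
    BiratUnits.Intertwines (pf_isFrobenioid π hF) ψ
      (BiratUnits.unitsToBirat (pf_isFrobenioid π hF) X
        (unitsPerfEquivNat X (Frobenioids.Perfection.of _ (D0.unitPull (π.map (Base (pfStr π hF) ψ)) w))))
      (BiratUnits.unitsToBirat (pf_isFrobenioid π hF) X' (unitsPerfEquivNat X' (Frobenioids.Perfection.of _ w))) := by
  rw [unitsPerfEquivNat_eq, unitsPerfEquivNat_eq, unitRekey_of, unitRekey_of,
    map_pow (Frobenioids.Perfection.of _), map_pow (Frobenioids.Perfection.of _), unitsPerfEquiv_pow,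
    unitsPerfEquiv_pow]
  exact intertwines_unitsPerfEquiv_pow_pull (pf_isFrobenioid π hF) ψ hψ w

end Thm36Sub

end ArchFrd

end Literature.AlgebraicGeometry.Frobenioids

end
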